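import Mathlib
import Literature.Computability.Complexity.CircuitClasses
import Literature.Computability.Complexity.Classes
import Literature.Computability.Complexity.ConstantDepth
import Literature.Computability.Complexity.Promise
import Literature.Computability.MetaComplexity.FormulaModelsAE
import Literature.Computability.MetaComplexity.LevinKt
import Literature.Computability.MetaComplexity.XorBottomModelsAE
import Literature.Computability.MetaComplexity.OliveiraPichSanthanam2019.GapMKtPMagnification
import Literature.Computability.MetaComplexity.ChenJinWilliams2019.SparseConstantDepthMagnification
import HarnessLib

/-!
# Oliveira–Pich–Santhanam, Theorem 1.1 items 3, 4, 8: hardness magnification for `Gap-MKtP`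
# against `AND-THR-THR-XOR[N^{1+ε}]`, `MAJ⁰_{2d'+d+1}{N^{1+(2/d')+ε}}` (wires) and
# `(AC⁰[6])[N^{1+ε}]` — as named facts (census row R20, constant-depth models)

Source: I. C. Oliveira, J. Pich, R. Santhanam, *Hardness magnification near state-of-the-art lower
bounds*, Theory of Computing 17(11), 2021 (CCC 2019) (bib key `OliveiraPichSanthanam2021`; held text
`paper:doi-10-4086-toc-2021-v017a011`), Theorem 1.1 (p. 5 L8–27), Notation (p. 4 L25–35), proof
sketch for these items (p. 16 L3–31), Table 1 (p. 3). Companion of `GapMKtPMagnification.lean`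
(items 1, 5, 6; the thresholds `powThreshold`, `powLogThreshold`, `powSize`) and
`GapMKtPFormulaXor.lean` (item 2), over the constant-depth vocabulary of
`ChenJinWilliams2019.SparseConstantDepthMagnification` (`ltfBasis`, `Circuit.wires`, `ACdModSIZEae`,
`TCdWIRESae`) and `XorBottomModelsAE` (`parityGates`, `Circuit.XorAtBottom`).

## The printed statements (verbatim)

* Notation (p. 4 L25–35): *"We also consider bounded-depth majority circuits, where each internal
  gate computes a boolean-valued majority function (MAJ) of the form ∑_{i∈S} y_i ≥? t (the circuit
  has access to input literals x_1, …, x_n, ¬x_1, …, ¬x_n). We measure the size of such circuits by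
  the number of wires in the circuit. Depth-d majority circuits of size s will de[sic] denoted by
  MAJ⁰_d{s}, where d ≥ 1 is fixed. The choice of braces {} is supposed to emphasize that the size is
  measured by the number of wires. We also consider threshold circuits whose internal gates compute
  threshold functions (THR) of the form ∑_{i∈S} w_i · y_i ≥? t, for w_i, t ∈ ℝ. We count gates in this
  case, and let TC⁰_d[s] denote the corresponding class of circuits. … More generally, for a circuit
  class C, we use C[s] to denote C-circuits of size ≤ s, where size is measured by number of gates."*
* Theorem 1.1 (p. 5 L8–27): *"There is a universal constant c ≥ 1 for which the following hold. If
  there exists ε > 0 such that for every small enough β > 0 … 3. Gap-MKtP[2^{βn}, 2^{βn} + cn] ∉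
  AND-THR-THR-XOR[N^{1+ε}], then EXP ⊄ TC⁰_2[poly]. 4. Gap-MKtP[2^{βn}, 2^{βn} + cn] ∉
  MAJ⁰_{2d'+d+1}{N^{1+(2/d')+ε}}, then EXP ⊄ MAJ⁰_d{poly}. … 8. Gap-MKtP[2^{βn}, 2^{βn} + cn] ∉
  (AC⁰[6])[N^{1+ε}], then EXP ⊄ AC⁰[6]."* (`n = log N`.)
* Proof sketch (p. 16 L13–31): *"E_N(x) ∈ {0,1}^M can be computed by a multi-output circuit from
  MAJ⁰_{2d'}{O(N^{1+(2/d')})}, where circuit size is measured by number of wires. … under the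
  assumption that EXP ⊆ MAJ⁰_d{poly} the final depth of the circuit solving Gap-MKtP is 2d' + d + 1
  … the overall size (number of wires) of the circuit is O(N^{1+(2/d')}) + O(N^{1+ε}) + O(N) ≤
  N^{1+(2/d')+ε}. Item (3) is established analogously to Item (2): Assuming EXP ⊆ TC⁰_2[poly], we
  conclude that G_γ^{(j)}(w) can be computed by a THR-THR-XOR circuit of size at most N^{ε/2}
  (counted as a number of gates) and G_γ(w) by an AND-THR-THR-XOR circuit of size at most N^{1+ε}.
  Item (8) uses that parity gates can be simulated using O(1) mod 6 gates. That is, assuming EXP ⊆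
  AC⁰[6], we conclude that G_γ^{(j)}(w) can be computed by an AC⁰[6] circuit of size at most N^{ε/2}
  and G_γ(w) by an AC⁰[6] circuit of size at most N^{1+ε}."*
* Table 1 (p. 3, the KNOWN side in print, explicit functions — census context only, rule F10):
  *"Low-depth threshold circuits: P ⊄ MAJ∘THR∘THR[N^{3/2−o(1)}] [30]. Depth-d threshold circuits:
  P ⊄ TC⁰_d[N^{1+exp(−d)}] (wires) [25]. Depth-d circuits with mod gates: quasi-NP ⊄ ACC⁰_d[poly]
  [43]. … Establishing stronger lower bounds in these different models is open (or non-trivial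
  lower bounds for a function in E = DTIME[2^{O(N)}] in the case of ACC⁰_d)."*

## Census value (row R20, items 3, 4, 8)

All three are THRESHOLD facts (T). For none of the three hypothesis models does the source (or any
source found) print a lower bound for `Gap-MKtP` / `MKtP`: the K cell is EMPTY in the same model
(Table 1 lists explicit-function records in NEIGHBOURING models: Kane–Williams for
`MAJ∘THR∘THR` gates, Impagliazzo–Paturi–Saks for `TC⁰_d` wires, Murray–Williams for `ACC⁰` —
context, never subtracted). Item 8's conclusion `EXP ⊄ AC⁰[6]` is itself OPEN (Table 1: "non-trivial
lower bounds for a function in E … in the case of ACC⁰_d" are open), so no `AC⁰[6]` bound for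
`MKtP ∈ EXP` can be in print. Verdict per item: NO K IN MODEL — no numeric gap is printed or
computed (rule F3).

## Rendering (T side: our hypothesis implies the printed one; our conclusion follows from print's)

* `Gap-MKtP[2^{βn}, 2^{βn} + cn]` ↦ `U.gapMKtP (powThreshold β) (powLogThreshold β c)` exactly as in
  `GapMKtPMagnification.lean` (integer `Kt` = `UniversalMachine.levinKt`, exact floors;
  `∀ U : UniversalMachine`, `c` depending on `U`; "for every small enough β" ↦ `∃ β₀ > 0, ∀ β ∈
  (0, β₀)`).
* Item 3, hypothesis class `AND-THR-THR-XOR[s]` (gates) ↦ `LTF3XORae s`: the almost-everywhere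
  `FamilyAE` class of circuits over `ltfBasis ∪ parityGates` (integer-weight linear threshold gates
  of every arity — `∧ₖ`, `∨ₖ`, `¬`, every real-weight `THR` gate has an integer realisation — plus
  parity gates), parity gates reading INPUTS only (`XorAtBottom`), `acDepth ≤ 4` (negations
  weightless) and `Circuit.size ≤ s n` gates. A printed AND∘THR∘THR∘XOR circuit with `s` gates whose
  XOR layer reads literals is one of ours with the SAME gates (a parity of literals is a parity of
  variables or its complement, and a complemented parity feeding a THR gate is absorbed into that
  gate's weights and threshold), depth `1+1+1+1 = 4`, size `s`; ours is NOT required to be layered,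
  so our class is LARGER and a lower bound against it implies the printed hypothesis. A.e. vs
  every-length: the a.e. class contains the every-length one.
* Item 3, conclusion `EXP ⊄ TC⁰_2[poly]` (gates) ↦ `¬ (EXP ⊆ LTFdPoly 2)` with `LTFdPoly d` := languages
  decided at every length by depth-`d` (`acDepth`), polynomially many gates over `ltfBasis`. Ours is
  CONTAINED in print's `TC⁰_2[poly]`: integer weights are real weights; a `¬` gate inside one of our
  circuits (depth-free in `acDepth`) is absorbed into the weights of the THR gate it feeds, and a `¬`
  at the output flips the output gate (`¬[θ ≤ Σ wᵢyᵢ] = [1−θ ≤ Σ (−wᵢ)yᵢ]`), so every circuit of ours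
  is a printed depth-2 THR∘THR circuit with no more gates. Hence print's conclusion implies ours.
* Item 4, hypothesis class `MAJ⁰_D{s}` (wires, `D = 2d'+d+1`) ↦ `TCdWIRESae D s` of
  `ChenJinWilliams2019` (LTF gates, `acDepth ≤ D`, `Circuit.wires ≤ s n`, a.e.): an unweighted
  `MAJ` gate `[t ≤ Σ_{i∈S} yᵢ]` is an LTF gate; negated input literals cost us one `¬` gate and one
  wire per variable (`≤ N` extra wires, `N^{1+(2/d')+ε/2} + N ≤ ⌊N^{1+(2/d')+ε}⌋` for large `N`,
  absorbed by `∃ ε`: ours at `ε` implies print's at `ε/2`); depth = number of gate levels both ways.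
  Our class is LARGER (weighted gates allowed), so our hypothesis implies the printed one.
* Item 4, conclusion `EXP ⊄ MAJ⁰_d{poly}` ↦ `¬ (EXP ⊆ MAJdPoly d)` with `MAJdPoly d` := languages decided
  at every length by depth-`d`, polynomial-size circuits over the tree's `tcBasis` (`∧ₖ = [k ≤ Σ yᵢ]`,
  `∨ₖ = [1 ≤ Σ yᵢ]`, `MAJₖ = [⌈k/2⌉ ≤ Σ yᵢ]` — all unweighted printed MAJ gates — and `¬`). Ours is
  CONTAINED in print's `MAJ⁰_d{poly}`: negations are pushed to the literals through the self-dual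
  identity `¬[t ≤ Σ_{i∈S} yᵢ] = [|S|−t+1 ≤ Σ_{i∈S} ¬yᵢ]` (each gate possibly duplicated in both
  polarities, size `×2`, depth unchanged); an argument wired twice to the same sub-gate (our gates
  take argument TUPLES) is an integer weight `≤ poly`, realised by duplicating the sub-circuit
  (polynomial blow-up, depth unchanged); polynomially many gates ⟹ polynomially many wires. Hence
  print's conclusion implies ours. (`MAJdPoly d ⊆ TC0`: the conclusion is WEAKER than `EXP ⊄ TC⁰`,
  see `not_EXP_subset_MAJdPoly_of_not_subset_TC0`.) Print fixes `d ≥ 1` (p. 4) and `d' ≥ 1`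
  (Theorem 3.7); both guards are kept.
* Item 8, hypothesis class `(AC⁰[6])[s]` ↦ `∀ d, … ∉ promiseLift (ACdModSIZEae 6 d s)`: a language is
  in `(AC⁰[6])[s]` iff it is in `AC_d[6][s]` for SOME constant `d`, so "`∉ (AC⁰[6])[s]`" is "`∀ d, ∉
  AC_d[6][s]`". `ACdModSIZEae 6 d` counts `¬` gates (print's negations may be free literals: `≤ N`
  extra gates, absorbed by `ε ↦ ε/2` as above; constants `∧₀`/`∨₀` cost depth `+1`, absorbed by
  `∀ d`). Our hypothesis implies the printed one.
* Item 8, conclusion `EXP ⊄ AC⁰[6]` ↦ `¬ (EXP ⊆ AC0Mod 6)` — the tree's `AC0Mod 6` (Arora–Barak Def.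
  14.3: constant depth, polynomial size, `∧, ∨, ¬, MOD₆` gates, every length) IS the printed class.
* NON-VACUITY (F1): every hypothesis class contains `PromiseProblem.ofLanguage headLang` (the
  projection `x₀`: no gates, no wires, depth 0) — `ofLanguage_headLang_mem_promiseLift_LTF3XORae`,
  `…_TCdWIRESae`, `…_ACdModSIZEae` below; so none of the three hypotheses is vacuous.
* HONEST FRAMING: THRESHOLD facts; the three hypotheses are OPEN; nothing here is an approach to the
  summit. The universal constant `c` is machine-dependent in our rendering (`∀ U, ∃ c`), as in items
  1, 2, 5, 6.
-/

noncomputable section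

namespace Literature.Computability.MetaComplexity.OliveiraPichSanthanam2019

open Filter Topology
open Literature.Computability.Complexity Literature.Computability.MetaComplexity
open UniversalMachine ChenJinWilliams2019

/-! ### Conclusion classes: `TC⁰_d[poly]` (LTF gates, gates) and `MAJ⁰_d{poly}` -/

/-- **`TC⁰_d[poly]`, tree rendering `LTFdPoly d`**: languages decided at every length by circuits
over integer-weight linear threshold gates (`ltfBasis`) of `acDepth ≤ d` and polynomially many gates.
Contained in the printed `TC⁰_d[poly]` (module docstring). [cite: OliveiraPichSanthanam2021, Notation p. 4 (TC⁰_d[s], gates)] -/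
def LTFdPoly (d : ℕ) : Set (Language Bool) :=
  {L | ∃ p : Polynomial ℕ, L ∈ DepthSizeClass ltfBasis (fun _ => d) (fun n => p.eval n)}

/-- **`MAJ⁰_d{poly}`, tree rendering `MAJdPoly d`**: languages decided at every length by circuits
over the majority basis `tcBasis` (`∧ₖ`, `∨ₖ`, `¬`, `MAJₖ` — unweighted threshold gates) of
`acDepth ≤ d` and polynomial size. Contained in the printed `MAJ⁰_d{poly}` (negation pushdown and
weight-by-duplication, module docstring). [cite: OliveiraPichSanthanam2021, Notation p. 4 (MAJ⁰_d{s}, wires)] -/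
def MAJdPoly (d : ℕ) : Set (Language Bool) :=
  {L | ∃ p : Polynomial ℕ, L ∈ DepthSizeClass tcBasis (fun _ => d) (fun n => p.eval n)}

/-- `MAJ⁰_d{poly} ⊆ TC⁰_d[poly]` in the tree renderings (`tcBasis ⊆ ltfBasis`). [folklore] -/
theorem MAJdPoly_subset_LTFdPoly (d : ℕ) : MAJdPoly d ⊆ LTFdPoly d := by
  rintro L ⟨p, hp⟩
  exact ⟨p, DepthSizeClass_mono tcBasis_subset_ltfBasis (fun _ => le_rfl) (fun _ => le_rfl) hp⟩

/-- `AC⁰_d ⊆ MAJ⁰_d{poly}` in the tree renderings (`acBasis ⊆ tcBasis`). [folklore] -/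
theorem ACd_subset_MAJdPoly (d : ℕ) : ACd d ⊆ MAJdPoly d := by
  intro L hL
  obtain ⟨p, hp⟩ := Set.mem_iUnion.1 hL
  exact ⟨p, DepthSizeClass_mono acBasis_subset_tcBasis (fun _ => le_rfl) (fun _ => le_rfl) hp⟩

/-- `MAJ⁰_d{poly} ⊆ TC⁰` (the tree's `TC0` is the union over all constant depths). [folklore] -/
theorem MAJdPoly_subset_TC0 (d : ℕ) : MAJdPoly d ⊆ TC0 := by
  rintro L ⟨p, hp⟩
  exact ⟨d, p, hp⟩

/-- `MAJdPoly` is monotone in the depth. [folklore] -/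
theorem MAJdPoly_mono {d d' : ℕ} (h : d ≤ d') : MAJdPoly d ⊆ MAJdPoly d' := by
  rintro L ⟨p, hp⟩
  exact ⟨p, DepthSizeClass_mono le_rfl (fun _ => h) (fun _ => le_rfl) hp⟩

/-- `LTFdPoly` is monotone in the depth. [folklore] -/
theorem LTFdPoly_mono {d d' : ℕ} (h : d ≤ d') : LTFdPoly d ⊆ LTFdPoly d' := by
  rintro L ⟨p, hp⟩
  exact ⟨p, DepthSizeClass_mono le_rfl (fun _ => h) (fun _ => le_rfl) hp⟩

/-- The item-4 conclusion is weaker than `EXP ⊄ TC⁰`: `¬ (EXP ⊆ TC0) → ¬ (EXP ⊆ MAJdPoly d)`.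
[folklore] -/
theorem not_EXP_subset_MAJdPoly_of_not_subset_TC0 (h : ¬ (EXP ⊆ TC0)) (d : ℕ) :
    ¬ (EXP ⊆ MAJdPoly d) := fun h' => h (h'.trans (MAJdPoly_subset_TC0 d))

/-- … and the item-3 conclusion at depth `2` implies the one at depth `1`, etc.:
`¬ (EXP ⊆ LTFdPoly d') → ¬ (EXP ⊆ LTFdPoly d)` for `d ≤ d'`. [folklore] -/
theorem not_EXP_subset_LTFdPoly_anti {d d' : ℕ} (hd : d ≤ d') (h : ¬ (EXP ⊆ LTFdPoly d')) :
    ¬ (EXP ⊆ LTFdPoly d) := fun h' => h (h'.trans (LTFdPoly_mono hd))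

/-! ### Hypothesis class of item 3: three LTF levels over a bottom parity level -/

/-- **`AND-THR-THR-XOR[s]` ⊆ `LTF3XORae s`** (almost everywhere, gates): circuit families over
`ltfBasis ∪ parityGates` whose members, for all large `n`, have their parity gates reading inputs
only, `acDepth ≤ 4` and at most `s n` gates. The printed layered class is contained in it (module
docstring). [cite: OliveiraPichSanthanam2021, Thm. 1.1 item 3 (AND-THR-THR-XOR[s]) and p. 16] -/
def LTF3XORae (s : ℕ → ℕ) : Set (Language Bool) :=
  FamilyAE fun n C => C.IsOver (ltfBasis ∪ parityGates) ∧ C.XorAtBottom ∧ C.acDepth ≤ 4 ∧ C.size ≤ s n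

/-- `LTF3XORae` is monotone in the (eventual) size bound. [folklore] -/
theorem LTF3XORae_mono {s s' : ℕ → ℕ} (h : ∃ n₁ : ℕ, ∀ n ≥ n₁, s n ≤ s' n) :
    LTF3XORae s ⊆ LTF3XORae s' := by
  obtain ⟨n₁, hn₁⟩ := h
  exact FamilyAE_mono ⟨n₁, fun n hn C hC => ⟨hC.1, hC.2.1, hC.2.2.1, hC.2.2.2.trans (hn₁ n hn)⟩⟩

/-- Non-vacuity (F1): `LTF3XORae s` is inhabited for every `s` (`headLang`: the projection `x₀`, no
gates). [folklore] -/
theorem headLang_mem_LTF3XORae (s : ℕ → ℕ) : headLang ∈ LTF3XORae s :=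
  headLang_mem_FamilyAE ⟨0, fun n _ =>
    ⟨Circuit.isOver_input _ 0, xorAtBottom_input _,
      by rw [OliveiraSanthanam2018.acDepth_input]; exact Nat.zero_le _,
      by rw [Circuit.size_input]; exact Nat.zero_le _⟩⟩

/-- Hence the hypothesis class of item 3 contains a promise problem. [folklore] -/
theorem ofLanguage_headLang_mem_promiseLift_LTF3XORae (s : ℕ → ℕ) :
    PromiseProblem.ofLanguage headLang ∈ promiseLift (LTF3XORae s) :=
  ofLanguage_mem_promiseLift_iff.2 (headLang_mem_LTF3XORae s)

/-- Non-vacuity of the item-4 hypothesis class (wires). [folklore] -/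
theorem ofLanguage_headLang_mem_promiseLift_TCdWIRESae (D : ℕ) (s : ℕ → ℕ) :
    PromiseProblem.ofLanguage headLang ∈ promiseLift (TCdWIRESae D s) :=
  ofLanguage_mem_promiseLift_iff.2 (headLang_mem_TCdWIRESae D s)

/-- Non-vacuity of the item-8 hypothesis classes. [folklore] -/
theorem ofLanguage_headLang_mem_promiseLift_ACdModSIZEae (m d : ℕ) (M : ℕ → ℕ) :
    PromiseProblem.ofLanguage headLang ∈ promiseLift (ACdModSIZEae m d M) :=
  ofLanguage_mem_promiseLift_iff.2 (headLang_mem_ACdModSIZEae m d M)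

/-! ### Item 3: `AND-THR-THR-XOR[N^{1+ε}]` ⟹ `EXP ⊄ TC⁰_2[poly]` -/

/-- **`Gap-MKtP[2^{βn}, 2^{βn} + cn] ∉ AND-THR-THR-XOR[N^κ]`** for the machine `U` (item 3 uses
`κ = 1 + ε`), rendered against the larger class `LTF3XORae (powSize κ)`.
[cite: OliveiraPichSanthanam2021, Thm. 1.1 item 3 (hypothesis)] -/
def GapMKtPLTF3XorLB (U : UniversalMachine) (c : ℕ) (κ β : ℝ) : Prop :=
  U.gapMKtP (powThreshold β) (powLogThreshold β c) ∉ promiseLift (LTF3XORae (powSize κ))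

/-- **Hypothesis of Theorem 1.1 item 3 for the constant `c`** (OPEN): *"there exists ε > 0 such that
for every small enough β > 0, Gap-MKtP[2^{βn}, 2^{βn} + cn] ∉ AND-THR-THR-XOR[N^{1+ε}]"*.
[cite: OliveiraPichSanthanam2021, Thm. 1.1 item 3 (hypothesis)] -/
def MKtPLTF3XorHypothesis (U : UniversalMachine) (c : ℕ) : Prop :=
  ∃ ε : ℝ, 0 < ε ∧ ∃ β₀ : ℝ, 0 < β₀ ∧ ∀ β : ℝ, 0 < β → β < β₀ → GapMKtPLTF3XorLB U c (1 + ε) β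

/-- **Oliveira–Pich–Santhanam, Theorem 1.1 item 3** as a named fact: *"There is a universal
constant c ≥ 1 for which the following hold. If there exists ε > 0 such that for every small enough
β > 0 … 3. Gap-MKtP[2^{βn}, 2^{βn} + cn] ∉ AND-THR-THR-XOR[N^{1+ε}], then EXP ⊄ TC⁰_2[poly]."*
Users take `(h : thm11_item3)`. [cite: OliveiraPichSanthanam2021, Thm. 1.1 item 3] -/
def thm11_item3 : Prop :=
  ∀ U : UniversalMachine, ∃ c : ℕ, 1 ≤ c ∧ (MKtPLTF3XorHypothesis U c → ¬ (EXP ⊆ LTFdPoly 2))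

/-! ### Item 4: `MAJ⁰_{2d'+d+1}{N^{1+(2/d')+ε}}` (wires) ⟹ `EXP ⊄ MAJ⁰_d{poly}` -/

/-- The printed depth `2d' + d + 1` of item 4. [cite: OliveiraPichSanthanam2021, Thm. 1.1 item 4] -/
def majDepth (d d' : ℕ) : ℕ := 2 * d' + d + 1

/-- The printed wire exponent `1 + (2/d') + ε` of item 4. [cite: OliveiraPichSanthanam2021, Thm. 1.1 item 4] -/
def majExp (d' : ℕ) (ε : ℝ) : ℝ := 1 + 2 / (d' : ℝ) + ε

/-- **`Gap-MKtP[2^{βn}, 2^{βn} + cn] ∉ MAJ⁰_D{N^κ}`** (wires) for the machine `U`, rendered against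
the larger class `TCdWIRESae D (powSize κ)` (LTF gates, `acDepth ≤ D`, `≤ ⌊N^κ⌋` wires a.e.).
[cite: OliveiraPichSanthanam2021, Thm. 1.1 item 4 (hypothesis)] -/
def GapMKtPTCWiresLB (U : UniversalMachine) (D c : ℕ) (κ β : ℝ) : Prop :=
  U.gapMKtP (powThreshold β) (powLogThreshold β c) ∉ promiseLift (TCdWIRESae D (powSize κ))

/-- **Hypothesis of Theorem 1.1 item 4 for `(c, d, d')`** (OPEN): *"there exists ε > 0 such that for
every small enough β > 0, Gap-MKtP[2^{βn}, 2^{βn} + cn] ∉ MAJ⁰_{2d'+d+1}{N^{1+(2/d')+ε}}"*.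
[cite: OliveiraPichSanthanam2021, Thm. 1.1 item 4 (hypothesis)] -/
def MKtPMajHypothesis (U : UniversalMachine) (c d d' : ℕ) : Prop :=
  ∃ ε : ℝ, 0 < ε ∧ ∃ β₀ : ℝ, 0 < β₀ ∧ ∀ β : ℝ, 0 < β → β < β₀ →
    GapMKtPTCWiresLB U (majDepth d d') c (majExp d' ε) β

/-- **Oliveira–Pich–Santhanam, Theorem 1.1 item 4** as a named fact: *"… 4. Gap-MKtP[2^{βn},
2^{βn} + cn] ∉ MAJ⁰_{2d'+d+1}{N^{1+(2/d')+ε}}, then EXP ⊄ MAJ⁰_d{poly}"* (for all fixed `d ≥ 1`,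
p. 4, and `d' ≥ 1`, Theorem 3.7). Users take `(h : thm11_item4)`.
[cite: OliveiraPichSanthanam2021, Thm. 1.1 item 4] -/
def thm11_item4 : Prop :=
  ∀ U : UniversalMachine, ∃ c : ℕ, 1 ≤ c ∧ ∀ d d' : ℕ, 1 ≤ d → 1 ≤ d' →
    (MKtPMajHypothesis U c d d' → ¬ (EXP ⊆ MAJdPoly d))

/-! ### Item 8: `(AC⁰[6])[N^{1+ε}]` ⟹ `EXP ⊄ AC⁰[6]` -/

/-- **`Gap-MKtP[2^{βn}, 2^{βn} + cn] ∉ AC_d[m][N^κ]`** (gates, a.e.) for the machine `U`.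
[cite: OliveiraPichSanthanam2021, Thm. 1.1 item 8 (hypothesis)] -/
def GapMKtPACModLB (U : UniversalMachine) (m d c : ℕ) (κ β : ℝ) : Prop :=
  U.gapMKtP (powThreshold β) (powLogThreshold β c) ∉ promiseLift (ACdModSIZEae m d (powSize κ))

/-- **Hypothesis of Theorem 1.1 item 8 for the constant `c`** (OPEN): *"there exists ε > 0 such that
for every small enough β > 0, Gap-MKtP[2^{βn}, 2^{βn} + cn] ∉ (AC⁰[6])[N^{1+ε}]"* — i.e. outside
`AC_d[6][N^{1+ε}]` for EVERY constant depth `d`. [cite: OliveiraPichSanthanam2021, Thm. 1.1 item 8 (hypothesis)] -/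
def MKtPACMod6Hypothesis (U : UniversalMachine) (c : ℕ) : Prop :=
  ∃ ε : ℝ, 0 < ε ∧ ∃ β₀ : ℝ, 0 < β₀ ∧ ∀ β : ℝ, 0 < β → β < β₀ →
    ∀ d : ℕ, GapMKtPACModLB U 6 d c (1 + ε) β

/-- **Oliveira–Pich–Santhanam, Theorem 1.1 item 8** as a named fact: *"… 8. Gap-MKtP[2^{βn},
2^{βn} + cn] ∉ (AC⁰[6])[N^{1+ε}], then EXP ⊄ AC⁰[6]."* Users take `(h : thm11_item8)`.
[cite: OliveiraPichSanthanam2021, Thm. 1.1 item 8] -/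
def thm11_item8 : Prop :=
  ∀ U : UniversalMachine, ∃ c : ℕ, 1 ≤ c ∧ (MKtPACMod6Hypothesis U c → ¬ (EXP ⊆ AC0Mod 6))

/-! ### API -/

/-- Consequence shape of item 3. [cite: OliveiraPichSanthanam2021, Thm. 1.1 item 3] -/
theorem not_EXP_subset_LTFdPoly_two (h : thm11_item3) (U : UniversalMachine)
    (hU : ∀ c : ℕ, 1 ≤ c → MKtPLTF3XorHypothesis U c) : ¬ (EXP ⊆ LTFdPoly 2) := by
  obtain ⟨c, hc, himp⟩ := h U
  exact himp (hU c hc)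

/-- Consequence shape of item 4. [cite: OliveiraPichSanthanam2021, Thm. 1.1 item 4] -/
theorem not_EXP_subset_MAJdPoly (h : thm11_item4) (U : UniversalMachine) {d d' : ℕ} (hd : 1 ≤ d)
    (hd' : 1 ≤ d') (hU : ∀ c : ℕ, 1 ≤ c → MKtPMajHypothesis U c d d') : ¬ (EXP ⊆ MAJdPoly d) := by
  obtain ⟨c, hc, himp⟩ := h U
  exact himp d d' hd hd' (hU c hc)

/-- Consequence shape of item 8. [cite: OliveiraPichSanthanam2021, Thm. 1.1 item 8] -/
theorem not_EXP_subset_AC0Mod_six (h : thm11_item8) (U : UniversalMachine)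
    (hU : ∀ c : ℕ, 1 ≤ c → MKtPACMod6Hypothesis U c) : ¬ (EXP ⊆ AC0Mod 6) := by
  obtain ⟨c, hc, himp⟩ := h U
  exact himp (hU c hc)

/-- `powSize` is monotone in the exponent from length `1` on. [folklore] -/
theorem powSize_mono_exp {κ κ' : ℝ} (hκ : κ ≤ κ') : ∃ n₁ : ℕ, ∀ n ≥ n₁, powSize κ n ≤ powSize κ' n :=
  ⟨1, fun _ hN => Nat.floor_le_floor (Real.rpow_le_rpow_of_exponent_le (by exact_mod_cast hN) hκ)⟩

/-- The item-3 lower bound is antitone in the gap constant `c`. [folklore] -/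
theorem GapMKtPLTF3XorLB.anti_const {U : UniversalMachine} {c c' : ℕ} {κ β : ℝ} (hc : c ≤ c')
    (h : GapMKtPLTF3XorLB U c' κ β) : GapMKtPLTF3XorLB U c κ β := fun hmem =>
  h (gapMKtP_mem_promiseLift_anti (fun _ => le_rfl) (powLogThreshold_mono_const β hc) hmem)

/-- … and antitone in the size exponent `κ`. [folklore] -/
theorem GapMKtPLTF3XorLB.anti_exp {U : UniversalMachine} {c : ℕ} {κ κ' β : ℝ} (hκ : κ ≤ κ')
    (h : GapMKtPLTF3XorLB U c κ' β) : GapMKtPLTF3XorLB U c κ β := fun hmem =>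
  h (promiseLift_mono (LTF3XORae_mono (powSize_mono_exp hκ)) hmem)

/-- The item-4 lower bound is antitone in `c`. [folklore] -/
theorem GapMKtPTCWiresLB.anti_const {U : UniversalMachine} {D c c' : ℕ} {κ β : ℝ} (hc : c ≤ c')
    (h : GapMKtPTCWiresLB U D c' κ β) : GapMKtPTCWiresLB U D c κ β := fun hmem =>
  h (gapMKtP_mem_promiseLift_anti (fun _ => le_rfl) (powLogThreshold_mono_const β hc) hmem)

/-- … antitone in the wire exponent `κ` … [folklore] -/
theorem GapMKtPTCWiresLB.anti_exp {U : UniversalMachine} {D c : ℕ} {κ κ' β : ℝ} (hκ : κ ≤ κ')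
    (h : GapMKtPTCWiresLB U D c κ' β) : GapMKtPTCWiresLB U D c κ β := fun hmem =>
  h (promiseLift_mono (TCdWIRESae_mono D (powSize_mono_exp hκ)) hmem)

/-- … and antitone in the depth `D`. [folklore] -/
theorem GapMKtPTCWiresLB.anti_depth {U : UniversalMachine} {D D' c : ℕ} {κ β : ℝ} (hD : D ≤ D')
    (h : GapMKtPTCWiresLB U D' c κ β) : GapMKtPTCWiresLB U D c κ β := fun hmem =>
  h (promiseLift_mono (TCdWIRESae_mono_depth hD _) hmem)

/-- The item-8 lower bound is antitone in `c`. [folklore] -/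
theorem GapMKtPACModLB.anti_const {U : UniversalMachine} {m d c c' : ℕ} {κ β : ℝ} (hc : c ≤ c')
    (h : GapMKtPACModLB U m d c' κ β) : GapMKtPACModLB U m d c κ β := fun hmem =>
  h (gapMKtP_mem_promiseLift_anti (fun _ => le_rfl) (powLogThreshold_mono_const β hc) hmem)

/-- … antitone in the size exponent `κ` … [folklore] -/
theorem GapMKtPACModLB.anti_exp {U : UniversalMachine} {m d c : ℕ} {κ κ' β : ℝ} (hκ : κ ≤ κ')
    (h : GapMKtPACModLB U m d c κ' β) : GapMKtPACModLB U m d c κ β := fun hmem =>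
  h (promiseLift_mono (ACdModSIZEae_mono m d (powSize_mono_exp hκ)) hmem)

/-- … and antitone in the depth `d`. [folklore] -/
theorem GapMKtPACModLB.anti_depth {U : UniversalMachine} {m d d' c : ℕ} {κ β : ℝ} (hd : d ≤ d')
    (h : GapMKtPACModLB U m d' c κ β) : GapMKtPACModLB U m d c κ β := fun hmem =>
  h (promiseLift_mono (ACdModSIZEae_mono_depth m hd _) hmem)

/-- An `AC_d[m]` lower bound (any `m`) implies the plain `AC_d` lower bound of the same size
(`ACdSIZEae d M ⊆ ACdModSIZEae m d M`). [folklore] -/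
theorem GapMKtPACModLB.toACd {U : UniversalMachine} {m d c : ℕ} {κ β : ℝ}
    (h : GapMKtPACModLB U m d c κ β) :
    U.gapMKtP (powThreshold β) (powLogThreshold β c) ∉
      promiseLift (OliveiraSanthanam2018.ACdSIZEae d (powSize κ)) := fun hmem =>
  h (promiseLift_mono (ACdSIZEae_subset_ACdModSIZEae m d _) hmem)

/-- The hypotheses are antitone in `c`; so each item yields the implication for every `c' ≥ c`.
[folklore] -/
theorem MKtPLTF3XorHypothesis.anti_const {U : UniversalMachine} {c c' : ℕ} (hc : c ≤ c')
    (h : MKtPLTF3XorHypothesis U c') : MKtPLTF3XorHypothesis U c := by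
  obtain ⟨ε, hε, β₀, hβ₀, hβ⟩ := h
  exact ⟨ε, hε, β₀, hβ₀, fun β h0 h1 => (hβ β h0 h1).anti_const hc⟩

/-- [folklore] -/
theorem MKtPMajHypothesis.anti_const {U : UniversalMachine} {c c' d d' : ℕ} (hc : c ≤ c')
    (h : MKtPMajHypothesis U c' d d') : MKtPMajHypothesis U c d d' := by
  obtain ⟨ε, hε, β₀, hβ₀, hβ⟩ := h
  exact ⟨ε, hε, β₀, hβ₀, fun β h0 h1 => (hβ β h0 h1).anti_const hc⟩

/-- [folklore] -/
theorem MKtPACMod6Hypothesis.anti_const {U : UniversalMachine} {c c' : ℕ} (hc : c ≤ c')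
    (h : MKtPACMod6Hypothesis U c') : MKtPACMod6Hypothesis U c := by
  obtain ⟨ε, hε, β₀, hβ₀, hβ⟩ := h
  exact ⟨ε, hε, β₀, hβ₀, fun β h0 h1 d => (hβ β h0 h1 d).anti_const hc⟩

/-- `thm11_item8` in "eventually in `c`" form. [folklore] -/
theorem thm11_item8_iff_eventually :
    thm11_item8 ↔ ∀ U : UniversalMachine, ∃ c : ℕ, 1 ≤ c ∧
      ∀ c' : ℕ, c ≤ c' → (MKtPACMod6Hypothesis U c' → ¬ (EXP ⊆ AC0Mod 6)) := by
  constructor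
  · intro h U
    obtain ⟨c, hc, himp⟩ := h U
    exact ⟨c, hc, fun c' hcc' h' => himp (h'.anti_const hcc')⟩
  · intro h U
    obtain ⟨c, hc, himp⟩ := h U
    exact ⟨c, hc, himp c le_rfl⟩

/-- The printed depth of item 4 is at least `d + 3` (`d' ≥ 1`): a genuine DEPTH surplus on the
hypothesis side. [folklore] -/
theorem le_majDepth {d d' : ℕ} (hd' : 1 ≤ d') : d + 3 ≤ majDepth d d' := by
  unfold majDepth; omega

/-- The printed wire exponent of item 4 exceeds `1 + ε` by `2/d' > 0` and is at most `3 + ε`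
(`d' ≥ 1`). [folklore] -/
theorem majExp_bounds {d' : ℕ} (hd' : 1 ≤ d') (ε : ℝ) :
    1 + ε < majExp d' ε ∧ majExp d' ε ≤ 3 + ε := by
  unfold majExp
  have h1 : (1 : ℝ) ≤ d' := by exact_mod_cast hd'
  have hpos : 0 < (2 : ℝ) / d' := div_pos two_pos (lt_of_lt_of_le one_pos h1)
  have hle : (2 : ℝ) / d' ≤ 2 := by
    rw [div_le_iff₀ (lt_of_lt_of_le one_pos h1)]; nlinarith
  constructor <;> linarith

end Literature.Computability.MetaComplexity.OliveiraPichSanthanam2019
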